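import Summits.QuantumFields.YangMills.Theorems.LuscherReductionTwistedTraceScalingInnerKernelComparison
import HarnessLib

/-!
# C4 INNER, brick D0⁺: kernel comparison with a REGIONAL relative error plus an ABSOLUTE tail — `|K₂ − sK₁| ≤ ηsK₁ + τ ⇒ |⟨u,K₂v⟩ − s⟨u,K₁v⟩| ≤ (ηsM₁ + τ·μ(X))‖u‖‖v‖`
# (lane A of S-BASE, crux `TwistedTraceScaling` stmt-QuantumFields-20203; sub-target C4-CORE; design note `pub/ym-fleet/ym-luscher-20007-p1/COARSE-DESIGN.md` §22.7)

The disprover's rigidity theorems (`Theorems/TwistedTraceScaling/Negative/ModelPerturbedNearRigidity.lean`, `…NearRegional.lean`) show that a c-dependent stiff Gaussian is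
never GLOBALLY relatively close to a c-independent `tensorKernel`: the relative bound `|K₂ − sK₁| ≤ ηsK₁` of brick D0 (`abs_form_sub_le_of_kernel_near`,
`abs_bilin_sub_le_of_kernel_near`) can only hold on a bulk region `S = {|q_j| ≤ ρ}`, with an ABSOLUTE (Gaussian-small) error `τ` off it.  Both are captured by the single
pointwise hypothesis `|K₂ − sK₁| ≤ ηsK₁ + τ` (on `S×S` the relative part, off it `τ` dominates since `K₁ ≥ 0`), and the conclusion follows from D0 by a SHIFT TRICK with no
new measure theory: for the constant shifts `K₁ᶜ := K₁ + τ/(ηs)`, `K₂ᶜ := K₂ + τ/η` one has `|K₂ᶜ − sK₁ᶜ| = |K₂ − sK₁| ≤ ηs·K₁ᶜ` (a GLOBAL relative bound), the row sums grow by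
`τμ(X)/(ηs)`, and the constant parts cancel in `⟨u,K₂ᶜv⟩ − s⟨u,K₁ᶜv⟩ = ⟨u,K₂v⟩ − s⟨u,K₁v⟩`.  RESULT ★★ `abs_bilin_sub_le_of_kernel_near_add` (finite measure):
`|⟨u,K₂v⟩ − s⟨u,K₁v⟩| ≤ (ηsM₁ + τ·μ(X))·‖u‖₂‖v‖₂`, and the quadratic case ★ `abs_form_sub_le_of_kernel_near_add`.
HONEST FRAMING: textbook kernel estimate; a brick of C4-CORE of the CONDITIONAL reduction route R2b1; not infinite volume, not a gap, not Clay.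
-/

set_option autoImplicit false

noncomputable section

open MeasureTheory

namespace Summit.QuantumFields.YangMills.Theorems.FemtoTransferGap.KernelComparison

open Literature.Analysis.OperatorTheory

variable {X : Type*} [MeasurableSpace X] {μ : Measure X} [IsFiniteMeasure μ]

/-- ★★ **Bilinear kernel comparison with relative-plus-absolute error** (shift trick on D0): on a finite measure space, if `K₁ ≥ 0` is symmetric with row sums `≤ M₁` and
`|K₂ − sK₁| ≤ ηsK₁ + τ` pointwise (`s, η > 0`, `τ ≥ 0`), then `|⟨u,K₂v⟩ − s⟨u,K₁v⟩| ≤ (ηsM₁ + τ·μ(X))·‖u‖₂‖v‖₂`. [cite: Helffer2013, Lemma 7.1] -/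
theorem abs_bilin_sub_le_of_kernel_near_add {K₁ K₂ : X → X → ℝ} {s η M₁ τ : ℝ} (hs : 0 < s) (hη : 0 < η) (hτ : 0 ≤ τ) (hM₁ : 0 ≤ M₁)
    (hK₁ : ∀ x y, 0 ≤ K₁ x y) (hsymm : ∀ x y, K₁ x y = K₁ y x) (hKint : ∀ x, Integrable (K₁ x) μ) (hrow : ∀ᵐ x ∂μ, ∫ y, K₁ x y ∂μ ≤ M₁)
    (hnear : ∀ x y, |K₂ x y - s * K₁ x y| ≤ η * s * K₁ x y + τ) {u v : X → ℝ} (hu : Integrable (fun x => u x ^ 2) μ)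
    (hv : Integrable (fun x => v x ^ 2) μ) (hu1 : Integrable u μ) (hv1 : Integrable v μ)
    (hmeas : AEStronglyMeasurable (fun p : X × X => u p.1 * K₂ p.1 p.2 * v p.2) (μ.prod μ))
    (hI : Integrable (fun p : X × X => |u p.1| * K₁ p.1 p.2 * |v p.2|) (μ.prod μ))
    (hIs : Integrable (fun p : X × X => u p.1 * K₁ p.1 p.2 * v p.2) (μ.prod μ))
    (hI₁ : Integrable (fun p : X × X => K₁ p.1 p.2 * u p.1 ^ 2) (μ.prod μ))
    (hI₂ : Integrable (fun p : X × X => K₁ p.1 p.2 * v p.2 ^ 2) (μ.prod μ)) :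
    |(∫ x, ∫ y, u x * K₂ x y * v y ∂μ ∂μ) - s * ∫ x, ∫ y, u x * K₁ x y * v y ∂μ ∂μ| ≤
      (η * s * M₁ + τ * (μ Set.univ).toReal) * (Real.sqrt (∫ x, u x ^ 2 ∂μ) * Real.sqrt (∫ x, v x ^ 2 ∂μ)) := by
  have hηs : 0 < η * s := mul_pos hη hs
  set c : ℝ := τ / (η * s) with hc
  have hc0 : 0 ≤ c := div_nonneg hτ hηs.le
  have hηsc : η * s * c = τ := by rw [hc]; field_simp
  set K₁' : X → X → ℝ := fun x y => K₁ x y + c with hK₁'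
  set K₂' : X → X → ℝ := fun x y => K₂ x y + s * c with hK₂'
  -- the product integrability of the cross term `u ⊗ v`
  have huv : Integrable (fun p : X × X => u p.1 * v p.2) (μ.prod μ) := hu1.mul_prod hv1
  have huva : Integrable (fun p : X × X => |u p.1| * |v p.2|) (μ.prod μ) := hu1.abs.mul_prod hv1.abs
  -- hypotheses of D0 for the shifted kernels
  have hK₁'0 : ∀ x y, 0 ≤ K₁' x y := fun x y => add_nonneg (hK₁ x y) hc0
  have hsymm' : ∀ x y, K₁' x y = K₁' y x := fun x y => by simp only [hK₁', hsymm x y]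
  have hrow' : ∀ᵐ x ∂μ, ∫ y, K₁' x y ∂μ ≤ M₁ + c * (μ Set.univ).toReal := by
    filter_upwards [hrow] with x hx
    have : ∫ y, K₁' x y ∂μ = ∫ y, K₁ x y ∂μ + c * (μ Set.univ).toReal := by
      simp only [hK₁']
      rw [integral_add (hKint x) (integrable_const c), integral_const, smul_eq_mul, mul_comm]
      simp [Measure.real]
    rw [this]; linarith
  have hnear' : ∀ x y, |K₂' x y - s * K₁' x y| ≤ η * s * K₁' x y := fun x y => by
    simp only [hK₁', hK₂']
    have e : K₂ x y + s * c - s * (K₁ x y + c) = K₂ x y - s * K₁ x y := by ring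
    rw [e, mul_add, hηsc]
    exact hnear x y
  have hmeas' : AEStronglyMeasurable (fun p : X × X => u p.1 * K₂' p.1 p.2 * v p.2) (μ.prod μ) := by
    have h2 : AEStronglyMeasurable (fun p : X × X => u p.1 * K₂ p.1 p.2 * v p.2 + s * c * (u p.1 * v p.2)) (μ.prod μ) :=
      hmeas.add (huv.aestronglyMeasurable.const_mul (s * c))
    refine h2.congr (ae_of_all _ fun p => ?_)
    simp only [hK₂']; ring
  have hI' : Integrable (fun p : X × X => |u p.1| * K₁' p.1 p.2 * |v p.2|) (μ.prod μ) := by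
    refine (hI.add (huva.const_mul c)).congr (ae_of_all _ fun p => ?_)
    simp only [hK₁', Pi.add_apply]; ring
  have hIs' : Integrable (fun p : X × X => u p.1 * K₁' p.1 p.2 * v p.2) (μ.prod μ) := by
    refine (hIs.add (huv.const_mul c)).congr (ae_of_all _ fun p => ?_)
    simp only [hK₁', Pi.add_apply]; ring
  have hI₁' : Integrable (fun p : X × X => K₁' p.1 p.2 * u p.1 ^ 2) (μ.prod μ) := by
    have h1 : Integrable (fun p : X × X => u p.1 ^ 2 * (1 : ℝ)) (μ.prod μ) := hu.mul_prod (integrable_const (1 : ℝ))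
    refine (hI₁.add (h1.const_mul c)).congr (ae_of_all _ fun p => ?_)
    simp only [hK₁', Pi.add_apply]; ring
  have hI₂' : Integrable (fun p : X × X => K₁' p.1 p.2 * v p.2 ^ 2) (μ.prod μ) := by
    have h1 : Integrable (fun p : X × X => (1 : ℝ) * v p.2 ^ 2) (μ.prod μ) := (integrable_const (1 : ℝ)).mul_prod hv
    refine (hI₂.add (h1.const_mul c)).congr (ae_of_all _ fun p => ?_)
    simp only [hK₁', Pi.add_apply]; ring
  -- D0 for the shifted kernels
  have hD0 := abs_bilin_sub_le_of_kernel_near hs.le hη.le (by positivity : 0 ≤ M₁ + c * (μ Set.univ).toReal) hK₁'0 hsymm' hrow' hnear'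
    hu hv hmeas' hI' hIs' hI₁' hI₂'
  -- the constant parts cancel
  have hI2 : Integrable (fun p : X × X => u p.1 * K₂ p.1 p.2 * v p.2) (μ.prod μ) := by
    refine ((hI.const_mul ((1 + η) * s)).add (huva.const_mul τ)).mono' hmeas (ae_of_all _ fun p => ?_)
    rw [Real.norm_eq_abs]
    have h := hnear p.1 p.2
    have hk := hK₁ p.1 p.2
    have h2 : |K₂ p.1 p.2| ≤ (1 + η) * s * K₁ p.1 p.2 + τ := by
      have := abs_sub_abs_le_abs_sub (K₂ p.1 p.2) (s * K₁ p.1 p.2)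
      rw [abs_of_nonneg (mul_nonneg hs.le hk)] at this
      nlinarith
    rw [abs_mul, abs_mul]
    simp only [Pi.add_apply]
    have hu0 := abs_nonneg (u p.1); have hv0 := abs_nonneg (v p.2)
    calc |u p.1| * |K₂ p.1 p.2| * |v p.2| ≤ |u p.1| * ((1 + η) * s * K₁ p.1 p.2 + τ) * |v p.2| := by gcongr
      _ = (1 + η) * s * (|u p.1| * K₁ p.1 p.2 * |v p.2|) + τ * (|u p.1| * |v p.2|) := by ring
  have hI2' : Integrable (fun p : X × X => u p.1 * K₂' p.1 p.2 * v p.2) (μ.prod μ) := by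
    refine (hI2.add (huv.const_mul (s * c))).congr (ae_of_all _ fun p => ?_)
    simp only [hK₂', Pi.add_apply]; ring
  have e2 : ∫ x, ∫ y, u x * K₂' x y * v y ∂μ ∂μ = (∫ x, ∫ y, u x * K₂ x y * v y ∂μ ∂μ) + s * c * ∫ p, u p.1 * v p.2 ∂(μ.prod μ) := by
    rw [← integral_prod _ hI2', ← integral_prod _ hI2, ← integral_const_mul, ← integral_add hI2 (huv.const_mul _)]
    refine integral_congr_ae (ae_of_all _ fun p => ?_)
    simp only [hK₂']; ring
  have e1 : ∫ x, ∫ y, u x * K₁' x y * v y ∂μ ∂μ = (∫ x, ∫ y, u x * K₁ x y * v y ∂μ ∂μ) + c * ∫ p, u p.1 * v p.2 ∂(μ.prod μ) := by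
    rw [← integral_prod _ hIs', ← integral_prod _ hIs, ← integral_const_mul, ← integral_add hIs (huv.const_mul _)]
    refine integral_congr_ae (ae_of_all _ fun p => ?_)
    simp only [hK₁']; ring
  have ecancel : (∫ x, ∫ y, u x * K₂' x y * v y ∂μ ∂μ) - s * ∫ x, ∫ y, u x * K₁' x y * v y ∂μ ∂μ =
      (∫ x, ∫ y, u x * K₂ x y * v y ∂μ ∂μ) - s * ∫ x, ∫ y, u x * K₁ x y * v y ∂μ ∂μ := by
    rw [e2, e1]; ring
  rw [ecancel] at hD0
  refine hD0.trans (le_of_eq ?_)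
  rw [show η * s * (M₁ + c * (μ Set.univ).toReal) = η * s * M₁ + η * s * c * (μ Set.univ).toReal by ring, hηsc]

/-- ★ **Quadratic case**: `|⟨f,K₂f⟩ − s⟨f,K₁f⟩| ≤ (ηsM₁ + τ·μ(X))·‖f‖₂²`. [cite: Helffer2013, Lemma 7.1] -/
theorem abs_form_sub_le_of_kernel_near_add {K₁ K₂ : X → X → ℝ} {s η M₁ τ : ℝ} (hs : 0 < s) (hη : 0 < η) (hτ : 0 ≤ τ) (hM₁ : 0 ≤ M₁)
    (hK₁ : ∀ x y, 0 ≤ K₁ x y) (hsymm : ∀ x y, K₁ x y = K₁ y x) (hKint : ∀ x, Integrable (K₁ x) μ) (hrow : ∀ᵐ x ∂μ, ∫ y, K₁ x y ∂μ ≤ M₁)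
    (hnear : ∀ x y, |K₂ x y - s * K₁ x y| ≤ η * s * K₁ x y + τ) {f : X → ℝ} (hf : Integrable (fun x => f x ^ 2) μ) (hf1 : Integrable f μ)
    (hmeas : AEStronglyMeasurable (fun p : X × X => f p.1 * K₂ p.1 p.2 * f p.2) (μ.prod μ))
    (hI : Integrable (fun p : X × X => |f p.1| * K₁ p.1 p.2 * |f p.2|) (μ.prod μ))
    (hIs : Integrable (fun p : X × X => f p.1 * K₁ p.1 p.2 * f p.2) (μ.prod μ))
    (hI₁ : Integrable (fun p : X × X => K₁ p.1 p.2 * f p.1 ^ 2) (μ.prod μ))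
    (hI₂ : Integrable (fun p : X × X => K₁ p.1 p.2 * f p.2 ^ 2) (μ.prod μ)) :
    |(∫ x, ∫ y, f x * K₂ x y * f y ∂μ ∂μ) - s * ∫ x, ∫ y, f x * K₁ x y * f y ∂μ ∂μ| ≤
      (η * s * M₁ + τ * (μ Set.univ).toReal) * ∫ x, f x ^ 2 ∂μ := by
  have h := abs_bilin_sub_le_of_kernel_near_add hs hη hτ hM₁ hK₁ hsymm hKint hrow hnear hf hf hf1 hf1 hmeas hI hIs hI₁ hI₂
  have h0 : 0 ≤ ∫ x, f x ^ 2 ∂μ := integral_nonneg fun x => sq_nonneg _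
  rwa [Real.mul_self_sqrt h0] at h


/-! ## The s-finite form: absolute tail paid in `L¹` (for the model space `C × ℝ^σ`, whose measure is infinite) — appended 2026-08-28 -/

section SFiniteTail

variable {Y : Type*} [MeasurableSpace Y] {ν : Measure Y} [SFinite ν]

/-- ★★ **Bilinear kernel comparison, relative-plus-absolute error, `L¹` tail** (any s-finite measure): if `K₁ ≥ 0` is symmetric with row sums `≤ M₁` and
`|K₂ − sK₁| ≤ ηsK₁ + τ` pointwise (any real `τ`), then `|⟨u,K₂v⟩ − s⟨u,K₁v⟩| ≤ ηsM₁·‖u‖₂‖v‖₂ + τ·‖u‖₁‖v‖₁` (Schur for the relative part, Fubini for the constant part; no finiteness of the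
measure — the tail is paid by the `L¹` norms of the test functions, i.e. by the measure of their supports). [cite: Helffer2013, Lemma 7.1] -/
theorem abs_bilin_sub_le_of_kernel_near_add_L1 {K₁ K₂ : Y → Y → ℝ} {s η M₁ τ : ℝ} (hs : 0 ≤ s) (hη : 0 ≤ η) (hM₁ : 0 ≤ M₁)
    (hK₁ : ∀ x y, 0 ≤ K₁ x y) (hsymm : ∀ x y, K₁ x y = K₁ y x) (hrow : ∀ᵐ x ∂ν, ∫ y, K₁ x y ∂ν ≤ M₁)
    (hnear : ∀ x y, |K₂ x y - s * K₁ x y| ≤ η * s * K₁ x y + τ) {u v : Y → ℝ} (hu : Integrable (fun x => u x ^ 2) ν)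
    (hv : Integrable (fun x => v x ^ 2) ν) (hu1 : Integrable u ν) (hv1 : Integrable v ν)
    (hmeas : AEStronglyMeasurable (fun p : Y × Y => u p.1 * K₂ p.1 p.2 * v p.2) (ν.prod ν))
    (hI : Integrable (fun p : Y × Y => |u p.1| * K₁ p.1 p.2 * |v p.2|) (ν.prod ν))
    (hIs : Integrable (fun p : Y × Y => u p.1 * K₁ p.1 p.2 * v p.2) (ν.prod ν))
    (hI₁ : Integrable (fun p : Y × Y => K₁ p.1 p.2 * u p.1 ^ 2) (ν.prod ν))
    (hI₂ : Integrable (fun p : Y × Y => K₁ p.1 p.2 * v p.2 ^ 2) (ν.prod ν)) :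
    |(∫ x, ∫ y, u x * K₂ x y * v y ∂ν ∂ν) - s * ∫ x, ∫ y, u x * K₁ x y * v y ∂ν ∂ν| ≤
      η * s * M₁ * (Real.sqrt (∫ x, u x ^ 2 ∂ν) * Real.sqrt (∫ x, v x ^ 2 ∂ν)) + τ * ((∫ x, |u x| ∂ν) * ∫ x, |v x| ∂ν) := by
  have huva : Integrable (fun p : Y × Y => |u p.1| * |v p.2|) (ν.prod ν) := hu1.abs.mul_prod hv1.abs
  -- integrability of the `K₂` integrand from the pointwise bound
  have hI2 : Integrable (fun p : Y × Y => u p.1 * K₂ p.1 p.2 * v p.2) (ν.prod ν) := by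
    refine ((hI.const_mul ((1 + η) * s)).add (huva.const_mul τ)).mono' hmeas (ae_of_all _ fun p => ?_)
    rw [Real.norm_eq_abs]
    have h := hnear p.1 p.2
    have hk := hK₁ p.1 p.2
    have h2 : |K₂ p.1 p.2| ≤ (1 + η) * s * K₁ p.1 p.2 + τ := by
      have := abs_sub_abs_le_abs_sub (K₂ p.1 p.2) (s * K₁ p.1 p.2)
      rw [abs_of_nonneg (mul_nonneg hs hk)] at this
      nlinarith
    rw [abs_mul, abs_mul]
    simp only [Pi.add_apply]
    have hu0 := abs_nonneg (u p.1); have hv0 := abs_nonneg (v p.2)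
    calc |u p.1| * |K₂ p.1 p.2| * |v p.2| ≤ |u p.1| * ((1 + η) * s * K₁ p.1 p.2 + τ) * |v p.2| := by gcongr
      _ = (1 + η) * s * (|u p.1| * K₁ p.1 p.2 * |v p.2|) + τ * (|u p.1| * |v p.2|) := by ring
  rw [← integral_prod _ hI2, ← integral_prod _ hIs, ← integral_const_mul, ← integral_sub hI2 (hIs.const_mul s)]
  -- pointwise bound by an integrable majorant
  have hpt : ∀ p : Y × Y, ‖u p.1 * K₂ p.1 p.2 * v p.2 - s * (u p.1 * K₁ p.1 p.2 * v p.2)‖ ≤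
      η * s * (|u p.1| * K₁ p.1 p.2 * |v p.2|) + τ * (|u p.1| * |v p.2|) := fun p => by
    rw [Real.norm_eq_abs]
    have e : u p.1 * K₂ p.1 p.2 * v p.2 - s * (u p.1 * K₁ p.1 p.2 * v p.2) = u p.1 * (K₂ p.1 p.2 - s * K₁ p.1 p.2) * v p.2 := by ring
    rw [e, abs_mul, abs_mul]
    have h := hnear p.1 p.2
    have hu0 := abs_nonneg (u p.1); have hv0 := abs_nonneg (v p.2)
    calc |u p.1| * |K₂ p.1 p.2 - s * K₁ p.1 p.2| * |v p.2| ≤ |u p.1| * (η * s * K₁ p.1 p.2 + τ) * |v p.2| := by gcongr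
      _ = η * s * (|u p.1| * K₁ p.1 p.2 * |v p.2|) + τ * (|u p.1| * |v p.2|) := by ring
  have hG : Integrable (fun p : Y × Y => η * s * (|u p.1| * K₁ p.1 p.2 * |v p.2|) + τ * (|u p.1| * |v p.2|)) (ν.prod ν) :=
    (hI.const_mul (η * s)).add (huva.const_mul τ)
  rw [← Real.norm_eq_abs]
  refine (norm_integral_le_of_norm_le hG (ae_of_all _ hpt)).trans ?_
  rw [integral_add (hI.const_mul (η * s)) (huva.const_mul τ), integral_const_mul, integral_const_mul, integral_prod _ hI,
    integral_prod_mul (μ := ν) (ν := ν) (fun x => |u x|) (fun y => |v y|)]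
  -- Schur for the relative part
  have hgoal : ∫ x, ∫ y, |u x| * K₁ x y * |v y| ∂ν ∂ν ≤ M₁ * (Real.sqrt (∫ x, u x ^ 2 ∂ν) * Real.sqrt (∫ x, v x ^ 2 ∂ν)) := by
    have hu' : Integrable (fun x => |u x| ^ 2) ν := hu.congr (ae_of_all _ fun x => (sq_abs (u x)).symm)
    have hv' : Integrable (fun x => |v x| ^ 2) ν := hv.congr (ae_of_all _ fun x => (sq_abs (v x)).symm)
    have hcol : ∀ᵐ y ∂ν, ∫ x, K₁ x y ∂ν ≤ M₁ := by
      filter_upwards [hrow] with y hy; simpa only [hsymm] using hy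
    have h := SchurTest.integral_integral_mul_kernel_mul_le_sqrt (μ := ν) (ν := ν) K₁ (fun x => |u x|) (fun y => |v y|) hM₁ hM₁ hK₁ hrow hcol hu' hv' hI
      (hI₁.congr (ae_of_all _ fun p => by simp only [sq_abs])) (hI₂.congr (ae_of_all _ fun p => by simp only [sq_abs]))
    simp only [sq_abs] at h
    refine h.trans (le_of_eq ?_)
    rw [Real.sqrt_mul_self hM₁, Real.sqrt_mul (integral_nonneg fun x => sq_nonneg _)]
  have h1 := mul_le_mul_of_nonneg_left hgoal (mul_nonneg hη hs)
  nlinarith [h1]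

/-- ★ **Quadratic case, `L¹` tail**: `|⟨f,K₂f⟩ − s⟨f,K₁f⟩| ≤ ηsM₁‖f‖₂² + τ‖f‖₁²`. [cite: Helffer2013, Lemma 7.1] -/
theorem abs_form_sub_le_of_kernel_near_add_L1 {K₁ K₂ : Y → Y → ℝ} {s η M₁ τ : ℝ} (hs : 0 ≤ s) (hη : 0 ≤ η) (hM₁ : 0 ≤ M₁)
    (hK₁ : ∀ x y, 0 ≤ K₁ x y) (hsymm : ∀ x y, K₁ x y = K₁ y x) (hrow : ∀ᵐ x ∂ν, ∫ y, K₁ x y ∂ν ≤ M₁)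
    (hnear : ∀ x y, |K₂ x y - s * K₁ x y| ≤ η * s * K₁ x y + τ) {f : Y → ℝ} (hf : Integrable (fun x => f x ^ 2) ν) (hf1 : Integrable f ν)
    (hmeas : AEStronglyMeasurable (fun p : Y × Y => f p.1 * K₂ p.1 p.2 * f p.2) (ν.prod ν))
    (hI : Integrable (fun p : Y × Y => |f p.1| * K₁ p.1 p.2 * |f p.2|) (ν.prod ν))
    (hIs : Integrable (fun p : Y × Y => f p.1 * K₁ p.1 p.2 * f p.2) (ν.prod ν))
    (hI₁ : Integrable (fun p : Y × Y => K₁ p.1 p.2 * f p.1 ^ 2) (ν.prod ν))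
    (hI₂ : Integrable (fun p : Y × Y => K₁ p.1 p.2 * f p.2 ^ 2) (ν.prod ν)) :
    |(∫ x, ∫ y, f x * K₂ x y * f y ∂ν ∂ν) - s * ∫ x, ∫ y, f x * K₁ x y * f y ∂ν ∂ν| ≤
      η * s * M₁ * ∫ x, f x ^ 2 ∂ν + τ * (∫ x, |f x| ∂ν) ^ 2 := by
  have h := abs_bilin_sub_le_of_kernel_near_add_L1 hs hη hM₁ hK₁ hsymm hrow hnear hf hf hf1 hf1 hmeas hI hIs hI₁ hI₂
  have h0 : 0 ≤ ∫ x, f x ^ 2 ∂ν := integral_nonneg fun x => sq_nonneg _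
  rwa [Real.mul_self_sqrt h0, ← sq] at h

end SFiniteTail

end Summit.QuantumFields.YangMills.Theorems.FemtoTransferGap.KernelComparison

end
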